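import Summits.AtomisticToContinuum.Crystallization.Theorems.ExcessDecayLiouvilleFineGrainsFlatComparison
import Summits.AtomisticToContinuum.Crystallization.Theorems.ThreeConeCertificateKeplerBoundLocLimRemoval
import Literature.MathematicalPhysics.StatisticalMechanics.LocalMatchingCompactness
import Literature.MathematicalPhysics.StatisticalMechanics.LennardJonesThermodynamicLimitProofs

/-!
# Route `HullExactificationCascade`, item `HullBulkOptimal` (stmt-AtomisticToContinuum-12090), I:
# the cut-and-paste bound for balls of a ground state, and site sums of separated sets

Support file for the item `HullExactificationCascade.HullBulkOptimal` ("hull elements are bulk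
optimal up to a volume error").  Two groups of elementary facts:

* § Cut-and-paste in a finite ground state (`exists_sum_siteEnergy_ball_le`): for a
  `r`-separated Lennard-Jones ground state `x` in `ℝ³`, a centre `c`, a radius `R ≥ 1` and the
  index set `S` of the particles in `closedBall c R`,
  `Σ_{i ∈ S} 𝓔ⁱ(x) ≤ 2 E(#S) + C(r) R²`.
  Proof: `Σ_{i ∈ S} 𝓔ⁱ = Σ_{S × S} V + X` with `X` the cross interaction `S × Sᶜ`; the
  multi-particle removal inequality `Σ_{i ∈ S} 𝓔ⁱ − ½ Σ_{S × S} V ≤ E(#S)` of the tree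
  (`sum_siteEnergy_sub_le_groundStateEnergy`: remove `S`, re-insert an optimal `#S`-cluster far
  away) gives `Σ_{i ∈ S} 𝓔ⁱ ≤ 2 E(#S) − X`, and `−X ≤ (1/6) Σ_{S × Sᶜ} |x_i − x_k|⁻⁶ ≤ C R²` is
  the surface bound `exists_crossSum_le` of the tree.
* § Site sums of a separated set `X ⊆ ℝ³` (`summable_lennardJones_site`,
  `tsum_site_le_sum_near`, `ncard_ball_le`): for `r`-separated `X` and `y ∈ X` the family
  `z ↦ V_LJ(|y − z|)` over `X ∖ {y}` is absolutely summable (`r⁻⁶` tail, dyadic shells of the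
  tree's `sum_inv_pow_le_of_separated`), its sum is at most the finite sum over the points
  within any radius `ρ ≥ 1` (the dropped terms are `≤ 0`), and `#(X ∩ B̄_R(c)) ≤ (2R/r + 1)³`.

All `[folklore]` (Blanc–Lewin 2015, §1.2–§1.3: "two groups of particles far away always attract
each other"; cut-and-paste behind `E(N)/N → e_∞`).
-/

noncomputable section

namespace Summit.AtomisticToContinuum.Crystallization.Theorems.HullBulkOptimal

open scoped BigOperators Topology
open Filter Set Metric
open Literature.MathematicalPhysics.StatisticalMechanics
open Summit.AtomisticToContinuum.Crystallization.Theorems.CoarseGrains.Negative.PredicateAPI (E3)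
open Summit.AtomisticToContinuum.Crystallization.Theorems.ExcessDecayLiouville
  (sum_inv_pow_le_of_separated)
open Summit.AtomisticToContinuum.Crystallization.Theorems.ExcessDecayLiouvilleFineGrains
  (exists_crossSum_le neg_inv_pow_six_le_lennardJones groundStateEnergy_le_interactionEnergy_of_le)
open Summit.AtomisticToContinuum.Crystallization.Theorems.KeplerBoundLocalLimit
  (sum_siteEnergy_sub_le_groundStateEnergy siteEnergy_eq_sum)

/-! ## § Cut-and-paste in a finite ground state -/

/-- **Balls of a ground state are bulk optimal up to a surface term.** For every `r > 0` there
is `C ≥ 0` such that for every `r`-separated Lennard-Jones ground state `x` in `ℝ³`, every centre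
`c`, every radius `R ≥ 1` and the set `S` of the particles in `closedBall c R`:
`Σ_{i ∈ S} 𝓔ⁱ(x) ≤ 2 E(#S) + C R²` (removal of `S` and far re-insertion of an optimal
`#S`-cluster; the slack is the attractive cross interaction across the sphere). [folklore] -/
theorem exists_sum_siteEnergy_ball_le {r : ℝ} (hr : 0 < r) : ∃ C : ℝ, 0 ≤ C ∧
    ∀ (N : ℕ) (x : Fin N → E3), IsGroundState lennardJones x →
      (∀ i j : Fin N, i ≠ j → r ≤ dist (x i) (x j)) →
      ∀ (c : E3) (R : ℝ), 1 ≤ R → ∀ S : Finset (Fin N),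
        (∀ j : Fin N, j ∈ S ↔ dist (x j) c ≤ R) →
        ∑ i ∈ S, siteEnergy lennardJones x i ≤
          2 * groundStateEnergy lennardJones 3 S.card + C * R ^ 2 := by
  obtain ⟨C₁, hC₁⟩ := exists_crossSum_le r hr
  refine ⟨|C₁| / 6, by positivity, ?_⟩
  intro N x hx hsep c R hR S hS
  have hcross := hC₁ N x hx.1 hsep c R hR S hS
  have hrem := sum_siteEnergy_sub_le_groundStateEnergy hx S
  -- `Σ_{i ∈ S} 𝓔ⁱ = Σ_{S × S} V + Σ_{S × Sᶜ} V`
  have hsite : ∑ i ∈ S, siteEnergy lennardJones x i =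
      ∑ i ∈ S, ∑ k ∈ S, lennardJones (dist (x i) (x k)) +
        ∑ i ∈ S, ∑ k ∈ Sᶜ, lennardJones (dist (x i) (x k)) := by
    rw [← Finset.sum_add_distrib]
    refine Finset.sum_congr rfl fun i _ => ?_
    rw [siteEnergy_eq_sum, ← Finset.sum_add_sum_compl S]
  -- the cross interaction is bounded below by the attractive tail
  have hc1 : -((1 / 6) * ∑ i ∈ S, ∑ k ∈ Sᶜ, (dist (x i) (x k))⁻¹ ^ 6) ≤
      ∑ i ∈ S, ∑ k ∈ Sᶜ, lennardJones (dist (x i) (x k)) := by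
    rw [Finset.mul_sum, ← Finset.sum_neg_distrib]
    refine Finset.sum_le_sum fun i _ => ?_
    rw [Finset.mul_sum, ← Finset.sum_neg_distrib]
    exact Finset.sum_le_sum fun k _ => neg_inv_pow_six_le_lennardJones _
  have hR2 : C₁ * R ^ 2 ≤ |C₁| * R ^ 2 :=
    mul_le_mul_of_nonneg_right (le_abs_self _) (by positivity)
  have hC : |C₁| / 6 * R ^ 2 = (1 / 6) * (|C₁| * R ^ 2) := by ring
  rw [hC]
  linarith

/-- **Far tail in a finite configuration.** In an injective `r`-separated configuration `p` of
`ℝ³`, for a particle `i`, a radius `R ≥ r` and any set `F` of particles at distance `≥ R` from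
`p i`: `Σ_{k ∈ F} V_LJ(|p i − p k|) ≥ −(1/6) · 1024/(r³ R³)` (`V_LJ ≥ −r⁻⁶/6` termwise and the
dyadic shell bound `sum_inv_pow_le_of_separated`). [folklore] -/
theorem neg_tail_le_sum_far {N : ℕ} {p : Fin N → E3} (hpinj : Function.Injective p)
    {r R : ℝ} (hr : 0 < r) (hrR : r ≤ R) (hpsep : ∀ k l : Fin N, k ≠ l → r ≤ dist (p k) (p l))
    (i : Fin N) (F : Finset (Fin N)) (hfar : ∀ k ∈ F, R ≤ dist (p k) (p i)) :
    -(1 / 6 * (1024 / (r ^ 3 * R ^ 3))) ≤ ∑ k ∈ F, lennardJones (dist (p i) (p k)) := by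
  classical
  have h6 : ∑ k ∈ F, (dist (p k) (p i))⁻¹ ^ (3 + 3) ≤ 1024 / (r ^ 3 * R ^ 3) := by
    have h := sum_inv_pow_le_of_separated (F.image p) (p i) (k := 3) (by norm_num) hr hrR ?_ ?_
    · rwa [Finset.sum_image fun a _ b _ h => hpinj h] at h
    · intro a ha b hb hab
      obtain ⟨k, -, rfl⟩ := Finset.mem_image.1 ha
      obtain ⟨l, -, rfl⟩ := Finset.mem_image.1 hb
      exact hpsep k l fun h => hab (h ▸ rfl)
    · intro a ha
      obtain ⟨k, hk, rfl⟩ := Finset.mem_image.1 ha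
      exact hfar k hk
  have h7 : ∀ k ∈ F, -((1 / 6) * (dist (p k) (p i))⁻¹ ^ (3 + 3)) ≤
      lennardJones (dist (p i) (p k)) := fun k _ => by
    rw [dist_comm]
    exact neg_inv_pow_six_le_lennardJones _
  calc -(1 / 6 * (1024 / (r ^ 3 * R ^ 3)))
      ≤ -((1 / 6) * ∑ k ∈ F, (dist (p k) (p i))⁻¹ ^ (3 + 3)) := by linarith
    _ = ∑ k ∈ F, -((1 / 6) * (dist (p k) (p i))⁻¹ ^ (3 + 3)) := by
        rw [Finset.mul_sum, Finset.sum_neg_distrib]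
    _ ≤ _ := Finset.sum_le_sum h7

/-! ## § Site sums of a separated set -/

/-- `|V_LJ(s)| ≤ (r⁻⁶/12 + 1/6) s⁻⁶` for `s ≥ r > 0` (`V_LJ = u²/12 − u/6`, `u = s⁻⁶ ≤ r⁻⁶`).
[folklore] -/
theorem abs_lennardJones_le {r s : ℝ} (hr : 0 < r) (hs : r ≤ s) :
    |lennardJones s| ≤ (r⁻¹ ^ 6 / 12 + 1 / 6) * (s⁻¹) ^ 6 := by
  have hs0 : 0 < s := hr.trans_le hs
  have h0 : 0 ≤ s⁻¹ := inv_nonneg.2 hs0.le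
  have h6 : (s⁻¹) ^ 6 ≤ (r⁻¹) ^ 6 := pow_le_pow_left₀ h0 (inv_anti₀ hr hs) 6
  have hu : 0 ≤ (s⁻¹) ^ 6 := pow_nonneg h0 6
  have hr6 : 0 ≤ (r⁻¹) ^ 6 := by positivity
  have h12 : (s⁻¹) ^ 12 = (s⁻¹) ^ 6 * (s⁻¹) ^ 6 := by ring
  rw [abs_le]
  unfold lennardJones
  rw [h12]
  constructor
  · nlinarith [mul_nonneg hu hu, mul_nonneg hr6 hu]
  · nlinarith [mul_nonneg hu (sub_nonneg.2 h6), mul_nonneg hr6 hu]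

variable {X : Set E3} {r : ℝ}

/-- **Site sums of a separated set are absolutely summable.** For an `r`-separated `X ⊆ ℝ³`
(`r > 0`) and `y ∈ X`, the family `z ↦ V_LJ(|y − z|)` over `{z ∈ X : z ≠ y}` is summable
(majorant `(r⁻⁶/12 + 1/6)|z − y|⁻⁶`, finite partial sums `≤ 1024 r⁻⁶` by the dyadic shell bound
`sum_inv_pow_le_of_separated`). [folklore] -/
theorem summable_lennardJones_site (hr : 0 < r)
    (hsep : ∀ a ∈ X, ∀ b ∈ X, a ≠ b → r ≤ dist a b) {y : E3} (hy : y ∈ X) :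
    Summable fun z : ↥({z : E3 | z ∈ X ∧ z ≠ y} : Set E3) => lennardJones (dist y (z : E3)) := by
  classical
  have hmaj : Summable fun z : ↥({z : E3 | z ∈ X ∧ z ≠ y} : Set E3) =>
      (r⁻¹ ^ 6 / 12 + 1 / 6) * (dist (z : E3) y)⁻¹ ^ (3 + 3) := by
    refine (summable_of_sum_le (fun _ => by positivity) (c := 1024 / (r ^ 3 * r ^ 3))
      fun u => ?_).mul_left _
    have h := sum_inv_pow_le_of_separated (u.image Subtype.val) y (k := 3) (by norm_num) hr
      le_rfl ?_ ?_
    · rwa [Finset.sum_image fun a _ b _ h => Subtype.ext h] at h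
    · intro a ha b hb hab
      obtain ⟨a', -, rfl⟩ := Finset.mem_image.1 ha
      obtain ⟨b', -, rfl⟩ := Finset.mem_image.1 hb
      exact hsep _ a'.2.1 _ b'.2.1 hab
    · intro a ha
      obtain ⟨a', -, rfl⟩ := Finset.mem_image.1 ha
      exact hsep _ a'.2.1 _ hy a'.2.2
  refine Summable.of_norm_bounded hmaj fun z => ?_
  rw [Real.norm_eq_abs, dist_comm]
  exact abs_lennardJones_le hr (hsep _ z.2.1 _ hy z.2.2)

/-- **Truncation of a site sum.** For an `r`-separated `X ⊆ ℝ³`, `y ∈ X`, a radius `ρ ≥ 1` and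
the finite set `F` of the points `z ∈ X`, `z ≠ y`, `dist z y ≤ ρ`:
`Σ'_{z ∈ X, z ≠ y} V_LJ(|y − z|) ≤ Σ_{z ∈ F} V_LJ(|y − z|)` — the dropped terms have
`|y − z| > ρ ≥ 1`, where `V_LJ ≤ 0`. [folklore] -/
theorem tsum_site_le_sum_near (hr : 0 < r)
    (hsep : ∀ a ∈ X, ∀ b ∈ X, a ≠ b → r ≤ dist a b) {y : E3} (hy : y ∈ X)
    {ρ : ℝ} (hρ : 1 ≤ ρ) (F : Finset E3)
    (hF : ∀ z : E3, z ∈ F ↔ z ∈ X ∧ z ≠ y ∧ dist z y ≤ ρ) :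
    ∑' z : ↥({z : E3 | z ∈ X ∧ z ≠ y} : Set E3), lennardJones (dist y (z : E3)) ≤
      ∑ z ∈ F, lennardJones (dist y z) := by
  classical
  have hs := summable_lennardJones_site hr hsep hy
  set T : Set E3 := {z : E3 | z ∈ X ∧ z ≠ y} with hT
  set G : Finset ↥T := F.subtype fun z => z ∈ T with hG
  rw [← hs.sum_add_tsum_compl (s := G)]
  have h1 : ∑ z ∈ G, lennardJones (dist y (z : E3)) = ∑ z ∈ F, lennardJones (dist y z) := by
    rw [hG, Finset.sum_subtype_eq_sum_filter (f := fun z => lennardJones (dist y z)),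
      Finset.filter_true_of_mem]
    intro z hz
    exact ⟨((hF z).1 hz).1, ((hF z).1 hz).2.1⟩
  have h2 : ∑' z : ↥((G : Set ↥T)ᶜ), lennardJones (dist y (z : E3)) ≤ 0 := by
    refine tsum_nonpos fun z => lennardJones_nonpos ?_
    have hz : (z : ↥T) ∉ G := z.2
    have hzF : ((z : ↥T) : E3) ∉ F := fun h => hz (Finset.mem_subtype.2 h)
    have hzT : ((z : ↥T) : E3) ∈ T := z.1.2
    have hfar : ¬ dist ((z : ↥T) : E3) y ≤ ρ := fun h => hzF ((hF _).2 ⟨hzT.1, hzT.2, h⟩)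
    rw [dist_comm]
    linarith [not_le.1 hfar]
  linarith

/-- **Packing count in a ball of a separated set.** For an `r`-separated `X ⊆ ℝ³` (`r > 0`),
`#{y ∈ X : dist y c ≤ R} ≤ (2R/r + 1)³` for `R ≥ 0` (the set is finite, then
`card_le_of_separated_of_dist_le`). [folklore] -/
theorem ncard_ball_le (hr : 0 < r) (hsep : ∀ a ∈ X, ∀ b ∈ X, a ≠ b → r ≤ dist a b)
    (c : E3) {R : ℝ} (hR : 0 ≤ R) :
    (({y : E3 | y ∈ X ∧ dist y c ≤ R} : Set E3).ncard : ℝ) ≤ (2 * R / r + 1) ^ 3 := by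
  have hfin : ({y : E3 | y ∈ X ∧ dist y c ≤ R} : Set E3).Finite :=
    finite_of_forall_le_dist_of_subset_closedBall hr
      (fun p hp q hq hpq => hsep p hp.1 q hq.1 hpq) (c := c) (R := R)
      (fun p hp => mem_closedBall.2 hp.2)
  rw [Set.ncard_eq_toFinset_card _ hfin]
  have h := card_le_of_separated_of_dist_le hfin.toFinset c hr hR
    (fun p hp => ((Set.Finite.mem_toFinset hfin).1 hp).2)
    (fun p hp q hq hpq => hsep p ((Set.Finite.mem_toFinset hfin).1 hp).1 q
      ((Set.Finite.mem_toFinset hfin).1 hq).1 hpq)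
  rwa [finrank_euclideanSpace_fin] at h

/-- A `tsum` over a finite set is the `Finset` sum over its `toFinset` (the item's outer sum over
the points of `X` in a ball is of this form). [folklore] -/
theorem tsum_finite_eq_sum {Y : Set E3} (hfin : Y.Finite) (f : E3 → ℝ) :
    ∑' y : ↥Y, f (y : E3) = ∑ y ∈ hfin.toFinset, f y := by
  rw [← Finset.tsum_subtype]
  exact tsum_congr_set_coe f hfin.coe_toFinset.symm

end Summit.AtomisticToContinuum.Crystallization.Theorems.HullBulkOptimal

end
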